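import Summits.ResolutionOfSingularities.ResolutionOfSingularities.Theorems.PurelyInseparableDim4ParamLiftPairs
import HarnessLib

/-!
# [OURS · res-dim4-pi · F4-C-loc] PARAMETRIC LIFT KIT, part 5: NORMAL FORM of term lists (collected coefficients) and
  the REDUCTION OF THE FIBRE LETTER MODULO A QUADRATIC RELATION `t² = c₁ t + c₀`

Cell `res-dim4-pi` (D-0157 DOOR 2, wave 2), seat `res-dim4-p-6` g4; sequel of `…ParamLift` / `…ParamLiftSources` /
`…ParamLiftPairs` (five-letter term lists `Terms 5 k`, letter index `4`, specialisation `spec f β`).  Two data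
transformations the format v6 checker (`…ParamCertSix`) applies to DERIVED chart data, each with its meaning:

* §8 **`normT = prune ∘ collect`** (merge equal five-letter exponents — `shearL`/`transVar`/`shearMonoL` produce duplicates —
  and drop zeros); **`evalT_normT`**.  After `normT` the single-term checks of parts 2–4 read COLLECTED coefficients: the
  v5 gap «a point dead by a SUM of raw terms» (census idx 388/389/567/568) disappears.
* §9 **`reduceQ c₁ c₀`** (`t^a ↦ α_a t + β_a` by `t² = c₁ t + c₀`, `redPow`); **`spec_reduceQ`**: unchanged specialisation at
  a root `x` of the quadratic (the analyser's ALG2 rule `t² = −1`, generalised): B's reply pinned to such a root, the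
  translated chart reduced may be LETTER-FREE again — a rational row where the certificate continues.
* §10 univariate coefficient lists (`evalL`, `mulL`, `powL`, `prodL`) and the CERTIFIED FACTORISATION `rootsPolyL A d₀ rts qds`
  `= A·T^{d₀}·∏(T − ρ)^m·∏(T² − c₁T − c₀)^m` (`root_cases_of_eval_eq_zero`); §11 **`prootsB` ⇒ `coord_cases_of_prootsB`**
  (ROOT-SET check, superseding part 2's `prootB`): the sources of a low `γ` move only in the letter `i` with one power of
  `t` and their collected `bᵢ`-coefficients ARE the factorisation ⇒ `bᵢ = 0` (only if `d₀ > 0`) ∨ `bᵢ = f ρ` listed ∨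
  `bᵢ` a root of a listed quadratic.

[OURS · counted 0 · instrument; AI kernel work, weaker than expert review.]  NOTHING here is a statement about resolution of
singularities; resolution in dimension `≥ 4` / characteristic `p > 0` is NOT proved by anything in this file.  bears_on:
LADDER-RESOLUTION:D157-DOOR2 (res-dim4-pi · F4-C-loc all fields · rows v6).  Host item: `stmt-ResolutionOfSingularities-16155`.
-/

set_option linter.dupNamespace false -- mandated namespace of this single-conjunct summit

noncomputable section

open MvPolynomial Finset
open scoped BigOperators

namespace Summit.ResolutionOfSingularities.ResolutionOfSingularities.Theorems.PIDim4

namespace ParamLift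

open Literature.AlgebraicGeometry.Resolution
open Literature.AlgebraicGeometry.Resolution.CentreBlowup
open StepKit

/-! ## §8 Normal form of term lists -/

section Normal

variable {n : ℕ} {R : Type} [CommRing R]

/-- add one term to a list, merging it into the first term with the same exponent. OURS. [folklore] -/
def insertT (t : (Fin n → ℕ) × R) : Terms n R → Terms n R
  | [] => [t]
  | u :: L => if u.1 = t.1 then (u.1, u.2 + t.2) :: L else u :: insertT t L

/-- `insertT` adds the term's monomial. OURS. [folklore] -/
theorem evalT_insertT (t : (Fin n → ℕ) × R) (L : Terms n R) :
    evalT (insertT t L) = monomial (expo t.1) t.2 + evalT L := by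
  induction L with
  | nil => simp [insertT]
  | cons u L ih =>
    by_cases h : u.1 = t.1
    · simp only [insertT, h, ite_true, evalT_cons, map_add]
      abel
    · simp only [insertT, h, ite_false, evalT_cons, ih]
      abel

/-- merge all terms with equal exponents. OURS. [folklore] -/
def collect : Terms n R → Terms n R
  | [] => []
  | t :: L => insertT t (collect L)

/-- `collect` presents the same polynomial. OURS. [folklore] -/
theorem evalT_collect (L : Terms n R) : evalT (collect L) = evalT L := by
  induction L with
  | nil => rfl
  | cons t L ih => rw [collect, evalT_insertT, ih, evalT_cons]

variable [DecidableEq R]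

/-- drop the terms with zero coefficient. OURS. [folklore] -/
def prune (L : Terms n R) : Terms n R := L.filter fun t => !decide (t.2 = 0)

/-- `prune` presents the same polynomial. OURS. [folklore] -/
theorem evalT_prune (L : Terms n R) : evalT (prune L) = evalT L := by
  induction L with
  | nil => rfl
  | cons t L ih =>
    unfold prune at ih ⊢
    rw [List.filter_cons]
    by_cases h : t.2 = 0
    · simp only [h, decide_true, Bool.not_true, evalT_cons, monomial_zero, zero_add]
      exact ih
    · simp only [h, decide_false, Bool.not_false, ite_true, evalT_cons, ih]

/-- **normal form**: collected coefficients, no zero terms. OURS. [folklore] -/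
def normT (L : Terms n R) : Terms n R := prune (collect L)

/-- **the normal form presents the same polynomial.** OURS. [folklore] -/
theorem evalT_normT (L : Terms n R) : evalT (normT L) = evalT L := by
  rw [normT, evalT_prune, evalT_collect]

end Normal

/-! ## §9 Reducing the fibre letter modulo a quadratic relation `t² = c₁ t + c₀` -/

section Quad

variable {k K : Type} [Field k] [Field K] (f : k →+* K)

/-- `t^a ≡ (redPow a).1 · t + (redPow a).2` modulo `t² = c₁ t + c₀`. OURS. [folklore] -/
def redPow (c₁ c₀ : k) : ℕ → k × k
  | 0 => (0, 1)
  | a + 1 => ((redPow c₁ c₀ a).1 * c₁ + (redPow c₁ c₀ a).2, (redPow c₁ c₀ a).1 * c₀)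

/-- the meaning of `redPow` at a root `x` of the quadratic. OURS. [folklore] -/
theorem pow_eq_of_redPow (c₁ c₀ : k) {x : K} (hx : x ^ 2 = f c₁ * x + f c₀) (a : ℕ) :
    x ^ a = f (redPow c₁ c₀ a).1 * x + f (redPow c₁ c₀ a).2 := by
  induction a with
  | zero => simp [redPow]
  | succ a ih =>
    rw [pow_succ, ih, redPow, map_add, map_mul, map_mul]
    have : x * x = f c₁ * x + f c₀ := by rw [← sq]; exact hx
    linear_combination f (redPow c₁ c₀ a).1 * this

/-- rewrite every term `c·x^e·t^a` as `cα_a·x^e·t + cβ_a·x^e`. OURS. [folklore] -/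
def reduceQ (c₁ c₀ : k) (L : Terms 5 k) : Terms 5 k :=
  L.flatMap fun t =>
    [(Function.update t.1 (Fin.last 4) 1, t.2 * (redPow c₁ c₀ (t.1 (Fin.last 4))).1),
      (Function.update t.1 (Fin.last 4) 0, t.2 * (redPow c₁ c₀ (t.1 (Fin.last 4))).2)]

/-- `spec` on a term whose letter exponent is overwritten. OURS. [folklore] -/
theorem spec_monomial_update (x : K) (e : Fin 5 → ℕ) (v : ℕ) (c : k) :
    spec f x (monomial (expo (Function.update e (Fin.last 4) v)) c) =
      C (f c * x ^ v) * monomial (expo (Fin.init e)) 1 := by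
  have hinit : Fin.init (Function.update e (Fin.last 4) v) = Fin.init e := by
    funext i
    simp only [Fin.init]
    rw [Function.update_of_ne (Fin.castSucc_lt_last i).ne]
  rw [spec_monomial, Function.update_self, hinit]

/-- **at a root of the quadratic the reduced list specialises to the same polynomial.** OURS. [folklore] -/
theorem spec_reduceQ (c₁ c₀ : k) {x : K} (hx : x ^ 2 = f c₁ * x + f c₀) (L : Terms 5 k) :
    spec f x (evalT (reduceQ c₁ c₀ L)) = spec f x (evalT L) := by
  induction L with
  | nil => simp [reduceQ]
  | cons t L ih =>
    simp only [reduceQ, List.flatMap_cons] at ih ⊢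
    rw [evalT_append, map_add, ih]
    conv_rhs => rw [evalT_cons, map_add, spec_monomial, pow_eq_of_redPow f c₁ c₀ hx]
    congr 1
    rw [evalT_cons, evalT_cons, evalT_nil, add_zero, map_add, spec_monomial_update, spec_monomial_update, pow_one,
      pow_zero, mul_one, ← add_mul, ← map_add C, map_mul, map_mul]
    congr 2
    ring

end Quad

/-! ## §10 Univariate coefficient lists: evaluation, products, the certified factorisation -/

section Univ

variable {k K : Type} [Field k] [Field K] (f : k →+* K)

/-- evaluation of an ascending coefficient list along `f` at `x`. OURS. [folklore] -/
def evalL (f : k →+* K) : List k → K → K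
  | [], _ => 0
  | c :: l, x => f c + x * evalL f l x

/-- pointwise sum (the longer tail kept). OURS. [folklore] -/
def addL : List k → List k → List k
  | [], m => m
  | a :: l, [] => a :: l
  | a :: l, b :: m => (a + b) :: addL l m

/-- `evalL` of a sum. OURS. [folklore] -/
theorem evalL_addL (x : K) : ∀ l m : List k, evalL f (addL l m) x = evalL f l x + evalL f m x
  | [], m => by simp [addL, evalL]
  | a :: l, [] => by simp [addL, evalL]
  | a :: l, b :: m => by rw [addL, evalL, evalL, evalL, evalL_addL x l m, map_add]; ring

/-- scalar multiple. OURS. [folklore] -/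
def smulL (c : k) (l : List k) : List k := l.map (c * ·)

/-- `evalL` of a scalar multiple. OURS. [folklore] -/
theorem evalL_smulL (c : k) (x : K) : ∀ l : List k, evalL f (smulL c l) x = f c * evalL f l x
  | [] => by simp [smulL, evalL]
  | a :: l => by
    have ih := evalL_smulL c x l
    simp only [smulL, List.map_cons] at ih ⊢
    rw [evalL, evalL, ih, map_mul]; ring

/-- product. OURS. [folklore] -/
def mulL : List k → List k → List k
  | [], _ => []
  | a :: l, m => addL (smulL a m) (0 :: mulL l m)

/-- `evalL` of a product. OURS. [folklore] -/
theorem evalL_mulL (x : K) : ∀ l m : List k, evalL f (mulL l m) x = evalL f l x * evalL f m x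
  | [], m => by simp [mulL, evalL]
  | a :: l, m => by rw [mulL, evalL_addL, evalL_smulL, evalL, evalL_mulL x l m, map_zero, evalL]; ring

/-- power. OURS. [folklore] -/
def powL (l : List k) : ℕ → List k
  | 0 => [1]
  | m + 1 => mulL l (powL l m)

/-- `evalL` of a power. OURS. [folklore] -/
theorem evalL_powL (x : K) (l : List k) : ∀ m : ℕ, evalL f (powL l m) x = evalL f l x ^ m
  | 0 => by simp [powL, evalL]
  | m + 1 => by rw [powL, evalL_mulL, evalL_powL x l m, pow_succ]; ring

/-- product of a list of lists. OURS. [folklore] -/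
def prodL (ls : List (List k)) : List k := ls.foldr mulL [1]

/-- `evalL` of a list product. OURS. [folklore] -/
theorem evalL_prodL (x : K) : ∀ ls : List (List k), evalL f (prodL ls) x = (ls.map fun l => evalL f l x).prod
  | [] => by simp [prodL, evalL]
  | l :: ls => by
    have ih := evalL_prodL x ls
    rw [prodL] at ih
    rw [prodL, List.foldr_cons, evalL_mulL, ih, List.map_cons, List.prod_cons]

/-- **the certified factorisation** `A · T^{d₀} · ∏ (T − ρ)^m · ∏ (T² − c₁T − c₀)^m` as a coefficient list
(`rts` = rational roots with multiplicities, `qds` = quadratic factors `(c₁, c₀, m)`). OURS. [folklore] -/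
def rootsPolyL (A : k) (d₀ : ℕ) (rts : List (k × ℕ)) (qds : List (k × k × ℕ)) : List k :=
  smulL A (mulL (powL [0, 1] d₀) (mulL (prodL (rts.map fun ρm => powL [-ρm.1, 1] ρm.2))
    (prodL (qds.map fun c => powL [-c.2.1, -c.1, 1] c.2.2))))

/-- the value of the certified factorisation. OURS. [folklore] -/
theorem evalL_rootsPolyL (A : k) (d₀ : ℕ) (rts : List (k × ℕ)) (qds : List (k × k × ℕ)) (x : K) :
    evalL f (rootsPolyL A d₀ rts qds) x = f A * x ^ d₀ *
      ((rts.map fun ρm => (x - f ρm.1) ^ ρm.2).prod *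
        (qds.map fun c => (x ^ 2 - f c.1 * x - f c.2.1) ^ c.2.2).prod) := by
  rw [rootsPolyL, evalL_smulL, evalL_mulL, evalL_powL, evalL_mulL, evalL_prodL, evalL_prodL, List.map_map,
    List.map_map]
  have hT : evalL f [0, 1] x = x := by simp [evalL]
  have h1 : ((fun l => evalL f l x) ∘ fun ρm : k × ℕ => powL [-ρm.1, 1] ρm.2) =
      fun ρm => (x - f ρm.1) ^ ρm.2 := by
    funext ρm
    simp only [Function.comp_apply, evalL_powL, evalL, map_neg, map_one, mul_zero, add_zero, mul_one]
    ring
  have h2 : ((fun l => evalL f l x) ∘ fun c : k × k × ℕ => powL [-c.2.1, -c.1, 1] c.2.2) =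
      fun c => (x ^ 2 - f c.1 * x - f c.2.1) ^ c.2.2 := by
    funext c
    simp only [Function.comp_apply, evalL_powL, evalL, map_neg, map_one, mul_zero, add_zero, mul_one]
    ring
  rw [hT, h1, h2]
  ring

/-- **the zeros of the certified factorisation**: `x = 0` (and `d₀ > 0`), a listed rational root, or a root of a listed
quadratic. OURS. [folklore] -/
theorem root_cases_of_eval_eq_zero {A : k} (hA : A ≠ 0) {d₀ : ℕ} {rts : List (k × ℕ)} {qds : List (k × k × ℕ)}
    {x : K} (h : evalL f (rootsPolyL A d₀ rts qds) x = 0) :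
    (0 < d₀ ∧ x = 0) ∨ (∃ ρm ∈ rts, x = f ρm.1) ∨ (∃ c ∈ qds, x ^ 2 = f c.1 * x + f c.2.1) := by
  rw [evalL_rootsPolyL] at h
  rcases mul_eq_zero.mp h with h12 | h34
  · rcases mul_eq_zero.mp h12 with hA0 | hx
    · exact absurd hA0 ((map_ne_zero_iff f f.injective).mpr hA)
    · left
      by_cases hd : d₀ = 0
      · rw [hd, pow_zero] at hx; exact absurd hx one_ne_zero
      · exact ⟨Nat.pos_of_ne_zero hd, (pow_eq_zero_iff hd).mp hx⟩
  · right
    rcases mul_eq_zero.mp h34 with h3 | h4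
    · left
      obtain ⟨y, hy, hy0⟩ := List.mem_map.mp (List.prod_eq_zero_iff.mp h3)
      refine ⟨y, hy, ?_⟩
      have := (pow_eq_zero_iff (by rintro h0; rw [h0, pow_zero] at hy0; exact one_ne_zero hy0)).mp hy0
      exact sub_eq_zero.mp this
    · right
      obtain ⟨c, hc, hc0⟩ := List.mem_map.mp (List.prod_eq_zero_iff.mp h4)
      refine ⟨c, hc, ?_⟩
      have := (pow_eq_zero_iff (by rintro h0; rw [h0, pow_zero] at hc0; exact one_ne_zero hc0)).mp hc0
      linear_combination this

/-- `evalL` as a finite sum over the degrees. OURS. [folklore] -/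
theorem evalL_eq_sum (x : K) : ∀ l : List k, evalL f l x = ∑ d ∈ Finset.range l.length, f (l.getD d 0) * x ^ d
  | [] => by simp [evalL]
  | c :: l => by
    rw [evalL, evalL_eq_sum x l, List.length_cons, Finset.sum_range_succ', List.getD_cons_zero, pow_zero, mul_one,
      add_comm, Finset.mul_sum]
    congr 1
    refine Finset.sum_congr rfl fun d _ => ?_
    rw [List.getD_cons_succ, pow_succ]
    ring

/-! ## §11 The ROOT-SET check: all roots of the collected univariate constraint on one letter -/

/-- the collected coefficient at `b_i`-degree `d` of the sources (which move only in `i`). OURS. [folklore] -/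
def uCoef (γ : Fin 4 → ℕ) (i : Fin 4) (src : Terms 5 k) (d : ℕ) : k :=
  ((src.filter fun t => t.1 i.castSucc - γ i = d).map fun t => t.2 * (((t.1 i.castSucc).choose (γ i) : ℕ) : k)).sum

omit [Field K] in
/-- `uCoef` of a cons. OURS. [folklore] -/
theorem uCoef_cons (γ : Fin 4 → ℕ) (i : Fin 4) (t : (Fin 5 → ℕ) × k) (src : Terms 5 k) (d : ℕ) :
    uCoef γ i (t :: src) d =
      (if t.1 i.castSucc - γ i = d then t.2 * (((t.1 i.castSucc).choose (γ i) : ℕ) : k) else 0) + uCoef γ i src d := by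
  unfold uCoef
  rw [List.filter_cons]
  by_cases h : t.1 i.castSucc - γ i = d
  · simp [h]
  · simp [h]

/-- **regrouping by degree**: the source sum is the evaluation of the collected coefficients. OURS. [folklore] -/
theorem sum_src_eq_sum_uCoef (γ : Fin 4 → ℕ) (i : Fin 4) (x : K) (N : ℕ) :
    ∀ src : Terms 5 k, (∀ t ∈ src, t.1 i.castSucc - γ i < N) →
      (src.map fun t => f (t.2 * (((t.1 i.castSucc).choose (γ i) : ℕ) : k)) * x ^ (t.1 i.castSucc - γ i)).sum =
        ∑ d ∈ Finset.range N, f (uCoef γ i src d) * x ^ d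
  | [], _ => by simp [uCoef]
  | t :: src, hN => by
    have ih := sum_src_eq_sum_uCoef γ i x N src fun t' ht' => hN t' (List.mem_cons_of_mem _ ht')
    have hmem : t.1 i.castSucc - γ i ∈ Finset.range N := Finset.mem_range.mpr (hN t List.mem_cons_self)
    rw [List.map_cons, List.sum_cons, ih]
    have hsplit : ∑ d ∈ Finset.range N, f (uCoef γ i (t :: src) d) * x ^ d =
        (∑ d ∈ Finset.range N, (if t.1 i.castSucc - γ i = d then
          f (t.2 * (((t.1 i.castSucc).choose (γ i) : ℕ) : k)) * x ^ d else 0)) +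
          ∑ d ∈ Finset.range N, f (uCoef γ i src d) * x ^ d := by
      rw [← Finset.sum_add_distrib]
      refine Finset.sum_congr rfl fun d _ => ?_
      rw [uCoef_cons]
      split_ifs
      · rw [map_add, add_mul]
      · rw [zero_add, zero_add]
    rw [hsplit, Finset.sum_ite_eq, if_pos hmem]

/-- a source moving only in `i`: its Taylor term is `f(c·C(eᵢ,γᵢ)) · β^a · bᵢ^{eᵢ−γᵢ}`. OURS. [folklore] -/
theorem pterm_eq_of_moves_only (β : K) (γ : Fin 4 → ℕ) (b : Fin 4 → K) {i : Fin 4} {t : (Fin 5 → ℕ) × k}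
    (hoff : ∀ m : Fin 4, m ≠ i → t.1 m.castSucc = γ m) :
    pterm f β γ b t = β ^ t.1 (Fin.last 4) *
      (f (t.2 * (((t.1 i.castSucc).choose (γ i) : ℕ) : k)) * b i ^ (t.1 i.castSucc - γ i)) := by
  unfold pterm
  rw [← Finset.mul_prod_erase univ _ (mem_univ i)]
  have hrest : (∏ m ∈ univ.erase i, (((t.1 m.castSucc).choose (γ m) : K) * b m ^ (t.1 m.castSucc - γ m))) = 1 :=
    Finset.prod_eq_one fun m hm => by
      rw [hoff m (ne_of_mem_erase hm), Nat.choose_self, Nat.sub_self, pow_zero, Nat.cast_one, mul_one]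
  rw [hrest, mul_one, map_mul, map_natCast]
  ring

variable [DecidableEq k]

/-- **root-set check** for the letter `i ∈ U`: `γ` low; every source of `γ` moves only in `xᵢ` and carries the same
power `a` of the fibre letter; `A ≠ 0`; and the collected univariate coefficients equal the certified factorisation
`rootsPolyL A d₀ rts qds` degree by degree. OURS. [folklore] -/
def prootsB (q : ℕ) (U : Finset (Fin 4)) (G : Terms 5 k) (γ : Fin 4 → ℕ) (i : Fin 4) (a : ℕ) (A : k) (d₀ : ℕ)
    (rts : List (k × ℕ)) (qds : List (k × k × ℕ)) : Bool :=
  !decide (γ = 0) && decide (∑ m, γ m < q) && decide (i ∈ U) && !decide (A = 0) &&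
    decide (∀ t ∈ srcTerms U γ G, (∀ m : Fin 4, m ≠ i → t.1 m.castSucc = γ m) ∧ t.1 (Fin.last 4) = a ∧
      t.1 i.castSucc - γ i < (rootsPolyL A d₀ rts qds).length) &&
    decide (∀ d ∈ Finset.range (rootsPolyL A d₀ rts qds).length,
      uCoef γ i (srcTerms U γ G) d = (rootsPolyL A d₀ rts qds).getD d 0)

omit [Field K] in
/-- the low-exponent data of a root-set check. OURS. [folklore] -/
theorem prootsB_low {q : ℕ} {U : Finset (Fin 4)} {G : Terms 5 k} {γ : Fin 4 → ℕ} {i : Fin 4} {a : ℕ} {A : k}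
    {d₀ : ℕ} {rts : List (k × ℕ)} {qds : List (k × k × ℕ)} (h : prootsB q U G γ i a A d₀ rts qds = true) :
    γ ≠ 0 ∧ ∑ m, γ m < q := by
  unfold prootsB at h
  simp only [Bool.and_eq_true, Bool.not_eq_true', decide_eq_false_iff_not, decide_eq_true_eq] at h
  exact ⟨h.1.1.1.1.1, h.1.1.1.1.2⟩

/-- **a root-set check pins the letter**: if the coefficient of `x^γ` vanishes at `b` (vanishing off `U`, `β ≠ 0`) then
`bᵢ = 0` (only if `d₀ > 0`), or `bᵢ = f ρ` for a listed `ρ`, or `bᵢ` is a root of a listed quadratic. OURS. [folklore] -/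
theorem coord_cases_of_prootsB {β : K} (hβ : β ≠ 0) {q : ℕ} {U : Finset (Fin 4)} {G : Terms 5 k} {γ : Fin 4 → ℕ}
    {i : Fin 4} {a : ℕ} {A : k} {d₀ : ℕ} {rts : List (k × ℕ)} {qds : List (k × k × ℕ)}
    (h : prootsB q U G γ i a A d₀ rts qds = true) {b : Fin 4 → K} (hb : ∀ m : Fin 4, m ∉ U → b m = 0)
    (hzero : coeff (expo γ) (PointBlowup.translate b (spec f β (evalT G))) = 0) :
    (0 < d₀ ∧ b i = 0) ∨ (∃ ρm ∈ rts, b i = f ρm.1) ∨ (∃ c ∈ qds, b i ^ 2 = f c.1 * b i + f c.2.1) := by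
  unfold prootsB at h
  simp only [Bool.and_eq_true, Bool.not_eq_true', decide_eq_false_iff_not, decide_eq_true_eq] at h
  obtain ⟨⟨⟨-, hA⟩, hsrc⟩, hcoef⟩ := h
  set R := rootsPolyL A d₀ rts qds with hR
  rw [coeff_translate_spec_evalT, sum_pterm_filter f β γ hb] at hzero
  change ((srcTerms U γ G).map (pterm f β γ b)).sum = 0 at hzero
  have hmap : (srcTerms U γ G).map (pterm f β γ b) = (srcTerms U γ G).map fun t => β ^ a *
      (f (t.2 * (((t.1 i.castSucc).choose (γ i) : ℕ) : k)) * b i ^ (t.1 i.castSucc - γ i)) :=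
    List.map_congr_left fun t ht => by rw [pterm_eq_of_moves_only f β γ b (hsrc t ht).1, (hsrc t ht).2.1]
  rw [hmap, List.sum_map_mul_left] at hzero
  have hsum : ((srcTerms U γ G).map fun t =>
      f (t.2 * (((t.1 i.castSucc).choose (γ i) : ℕ) : k)) * b i ^ (t.1 i.castSucc - γ i)).sum = 0 :=
    (mul_eq_zero.mp hzero).resolve_left (pow_ne_zero _ hβ)
  rw [sum_src_eq_sum_uCoef f γ i (b i) R.length _ (fun t ht => (hsrc t ht).2.2)] at hsum
  have hev : evalL f R (b i) = 0 := by
    rw [evalL_eq_sum, ← hsum]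
    exact Finset.sum_congr rfl fun d hd => by rw [hcoef d hd]
  exact root_cases_of_eval_eq_zero f hA hev

end Univ

end ParamLift

end Summit.ResolutionOfSingularities.ResolutionOfSingularities.Theorems.PIDim4

end
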